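import Summits.HodgeConjecture.HodgeConjecture.Theorems.R90S1SplitOpenCellJacquetKernel
import Summits.HodgeConjecture.HodgeConjecture.Theorems.R90S1SplitOpenCellDiagAction
import Summits.HodgeConjecture.HodgeConjecture.Theorems.R90S1SplitInducedEndScalarCriterion
import Summits.HodgeConjecture.HodgeConjecture.Theorems.R90S1SplitInducingDatumValues
import Literature.NumberTheory.Automorphic.SmoothIrrepAbelianByCompactFinite
import Literature.NumberTheory.Automorphic.MatrixCoefficientsSupercuspidalAdmissibleProofs
import Literature.NumberTheory.Automorphic.ParabolicGLExactProofs
import HarnessLib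

/-!
# R90-TF · S1 «Ch10-local» · split place, ROAD β — `End_{GL₃}(n-Ind_{P(2,1)}(σ ⊠ χ′)) = ℂ` when the `u₁₀`-exponents of `σ`
# avoid `√q · χ′(ϖ)` (the REGULAR non-supercuspidal branch, all characteristics)

Cell `hodgecm-mathlib`, programme R90-TF, section S1, crux H413 (`stmt-HodgeConjecture-24833`), route `HCCMUnconditional`;
prover seat R90-C10-p02, socket S1#7 `R90.S1.SocketSplitInducedIrreducible`, ROAD β «BY SUPPORT OF σ».  THEOREMS ONLY (no `def`,
no instance, no notation, no `sorry`); ONE public theorem; lane `--supports stmt-HodgeConjecture-24833`.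

THE MATHEMATICS ([BernsteinZelevinskyASENS1977, Thm. 5.2 for `(Q_{2,1}, Q_{2,1})`, §7.1]; [Casselman1995, §6.3]).  `P = Q_{2,1}`,
`τ = ((σ ⊠ χ′) ∘ proj) ⊗ δ_P^{1∕2}`, `I = Ind_P^{GL₃} τ`, `ϖ` a uniformizer, `d(ϖ) = diag(1,1,ϖ)` (central in the Levi, `τ(d(ϖ)) =
q χ′(ϖ)`), `d₀(ϖ) = diag(ϖ,1,1) = w₀ d(ϖ) w₀⁻¹` (`τ(d₀(ϖ)) = q^{-1∕2} σ(diag(ϖ,1))`).  A `(P, τ)`-equivariant `Λ : I_{U_P} → W`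
satisfies, on the spanning open-orbit classes `[r⁻¹ · Φ_{K,w}]`: (i) `Λ[r⁻¹ Φ_{K,w}] = 0` for `w` in the Jacquet kernel
`⟨σ(u₁₀ b) y - y⟩` (★ `mk_translate_cellSection_eq_zero_of_mem_jacquet_ker`); (ii) `q χ′(ϖ) Λ[r⁻¹ Φ_{K,w}] = Λ[d(ϖ) r⁻¹ Φ_{K,w}] =
q Λ[r⁻¹ Φ_{K, τ(d₀ ϖ) w}]` (★ `mk_smoothIndRep_diag_translate_cellSection`).  Hence `μ_r = Λ[r⁻¹ Φ_{K,·}]` factors through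
`W_{u₁₀(F)}` and `μ_r ∘ (σ(diag(ϖ,1)) - √q χ′(ϖ)) = 0`; if `σ(diag(ϖ,1)) - √q χ′(ϖ)` is SURJECTIVE modulo the Jacquet kernel
(REGULAR exponent: `√q χ′(ϖ)` is not an eigenvalue of `diag(ϖ,1)` on `W_{u₁₀(F)}` — e.g. `σ = St(ψ)`, `ψ ∘ det`, a complementary
series, or a unitary principal series `I₂(ψ₁,ψ₂)` with `χ′ ∉ {ψ₁, ψ₂}`), then `Λ` kills `I_open` and ★
`smoothIndRep_intertwiningMap_eq_smul_of_openCell_killed` gives **`End_{GL₃}(I) = ℂ`**.  No `[CharZero F]`, no admissibility, no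
unitarity.  HONEST LABEL: an organ of S1#7 (the irregular cases `χ′ ∈ {ψ₁, ψ₂}` and the complete-reducibility input remain), socket
OPEN; HC_CM is proved only modulo the 7 printed citations (2 remaining named inputs: hLiu418 = stmt-HodgeConjecture-24832,
h413 = stmt-HodgeConjecture-24833) until rung 0 closes.
References: [BernsteinZelevinskyASENS1977] Bernstein–Zelevinsky, Ann. Sci. ÉNS 10 (1977), Thm. 5.2, §7.1 · [Casselman1995] §6.3 ·
[Zelevinsky1980] Ann. Sci. ÉNS 13 (1980), §3.2, Thm. 4.2 · [Rogawski1990] §13.3 p. 201.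
-/

set_option autoImplicit false
set_option linter.dupNamespace false

noncomputable section

open Matrix Literature.LinearAlgebra.Matrix.DiagonalTorus
open Literature.NumberTheory.Automorphic Literature.NumberTheory.Automorphic.Zelevinsky1980
open Literature.NumberTheory.GaloisRepresentations
open ValuativeRel
open Summit.HodgeConjecture.HodgeConjecture.R90.S1.SplitCell

namespace Summit.HodgeConjecture.HodgeConjecture.R90.S1

variable {F : Type*} [Field F] [ValuativeRel F] [TopologicalSpace F] [IsNonarchimedeanLocalField F]
  {W : Type*} [AddCommGroup W] [Module ℂ W]

/-! ## §1 Regular exponent ⇒ every equivariant functional on `I_{U_P}` kills the open cell -/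

/-- **The exponent comparison on the open orbit.**  Let `τ` be a smooth representation of `P = Q_{2,1}` on `W`, `ι = u₁₀`, `ϖ` a
uniformizer, `d(ϖ) = diag(1,1,ϖ)` acting on `W` through `τ` by the scalar `e`, and suppose `q · τ(d₀(ϖ)) - e` is surjective
modulo the Jacquet kernel of `τ` along `u₁₀(F)`.  Then every `(P, τ)`-equivariant linear map `Λ : I_{U_P} → W` kills the classes
of the open-cell functions. [cite: BernsteinZelevinskyASENS1977, Thm. 5.2 and §7.1] -/
private theorem openCell_killed_of_regular
    (τ : Representation ℂ ↥(standardParabolicGL F (lastBlockLabel 3)) W) (hτs : τ.IsSmooth)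
    (ι : Multiplicative F →* ↥(standardParabolicGL F (lastBlockLabel 3)))
    (hι : ∀ b : F, ((ι (Multiplicative.ofAdd b) : ↥(standardParabolicGL F (lastBlockLabel 3))) : GL (Fin 3) F) =
      transvectionGL (1 : Fin 3) 0 (by decide) b)
    {ϖ : F} (hϖ : IsUniformizingElement ϖ) (e : ℂ)
    (he : ∀ w : W, τ ⟨diagGL (Fin 3) (Function.update 1 (Fin.last 2) (Units.mk0 ϖ hϖ.ne_zero)),
      diagGL_mem_standardParabolicGL _ _⟩ w = e • w)
    (hreg : ∀ w : W, ∃ w' : W,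
      (IsNonarchimedeanLocalField.residueFieldCard F : ℂ) • τ ⟨diagGL (Fin 3) (Function.update 1 0 (Units.mk0 ϖ hϖ.ne_zero)),
          diagGL_mem_standardParabolicGL _ _⟩ w' - e • w' - w ∈ Representation.Coinvariants.ker (τ.comp ι))
    (Λ : (Representation.restrictUnipotentGL F (lastBlockLabel 3)
      (Representation.smoothIndRep (standardParabolicGL F (lastBlockLabel 3)) τ)).Coinvariants →ₗ[ℂ] W)
    (hΛ : ∀ (p : ↥(standardParabolicGL F (lastBlockLabel 3)))
      (f : Representation.SmoothInd (standardParabolicGL F (lastBlockLabel 3)) τ),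
      Λ (Representation.Coinvariants.mk _
        (Representation.smoothIndRep (standardParabolicGL F (lastBlockLabel 3)) τ (p : GL (Fin 3) F) f)) =
        τ p (Λ (Representation.Coinvariants.mk _ f)))
    (f : Representation.SmoothInd (standardParabolicGL F (lastBlockLabel 3)) τ)
    (hf : f ∈ vanishingOn (standardParabolicGL F (lastBlockLabel 3)) τ (cellLT (K := F) (lastBlockLabel 3) Fin.revPerm)) :
    Λ (Representation.Coinvariants.mk _ f) = 0 := by
  classical
  -- the level box `K' = N' ∩ K_{ϖ^m}` fixing `f`
  obtain ⟨m, hm1, hstab⟩ := exists_congruenceGL_pow_subset (n := 3) hϖ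
    ((Representation.isSmooth_smoothInd (standardParabolicGL F (lastBlockLabel 3)) τ f).mem_nhds (Subgroup.one_mem _))
  have hγ0 : valuation F ϖ ^ m ≠ 0 := pow_ne_zero _ ((Valuation.ne_zero_iff _).mpr hϖ.ne_zero)
  have hγ1 : valuation F ϖ ^ m < 1 := hϖ.valuation_pow_lt_one hm1
  set K' : Subgroup ↥(oppositeCellRadical (K := F) (lastBlockLabel 3)) :=
    (congruenceGL 3 (valuation F ϖ ^ m)).comap (oppositeCellRadical (K := F) (lastBlockLabel 3)).subtype with hK'_def
  have hK'stab : ∀ k ∈ K', ∀ x : GL (Fin 3) F, f.toFun (x * (k : GL (Fin 3) F)) = f.toFun x := fun k hk x =>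
    toFun_w₀_mul_mul_of_mem_stabilizer (hstab hk) x
  obtain ⟨R, hR⟩ := exists_eq_sum_cellSection τ (monotone_lastBlockLabel 3) hτs K'
    (isOpen_comap_congruenceGL hγ0) (isCompact_comap_congruenceGL _) f hf hK'stab
  have hconjK : ∀ r : ↥(oppositeCellRadical (K := F) (lastBlockLabel 3)),
      conjSubgroup (oppositeCellRadical_le_reversedParabolic (lastBlockLabel 3) r.2) K' = K' := by
    intro r
    ext x
    rw [mem_conjSubgroup_iff]
    have : (radicalConj (oppositeCellRadical_le_reversedParabolic (lastBlockLabel 3) r.2)).symm x = x :=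
      Subtype.ext (by
        rw [coe_radicalConj_symm, mul_assoc, mul_comm_of_mem_oppositeCellRadical (n := 2) x.2 r.2, ← mul_assoc,
          inv_mul_cancel, one_mul])
    rw [this]
  rw [hR, map_sum, map_sum]
  refine Finset.sum_eq_zero fun r _ => ?_
  rw [cellSection_congr (monotone_lastBlockLabel 3) hτs (hconjK r) (isOpen_conjSubgroup _ (isOpen_comap_congruenceGL hγ0))
    (isCompact_conjSubgroup _ (isCompact_comap_congruenceGL _)) (isOpen_comap_congruenceGL hγ0)
    (isCompact_comap_congruenceGL _)]
  -- `μ w = Λ [r⁻¹ · Φ_{K', w}]`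
  set μ : W →ₗ[ℂ] W := Λ ∘ₗ Representation.Coinvariants.mk (Representation.restrictUnipotentGL F (lastBlockLabel 3) (Representation.smoothIndRep (standardParabolicGL F (lastBlockLabel 3)) τ)) ∘ₗ
      (Representation.smoothIndRep (standardParabolicGL F (lastBlockLabel 3)) τ) ((r : GL (Fin 3) F))⁻¹ ∘ₗ cellSectionₗ τ (monotone_lastBlockLabel 3) hτs K' (isOpen_comap_congruenceGL hγ0)
        (isCompact_comap_congruenceGL _) with hμ_def
  have hμ : ∀ w, μ w = Λ (Representation.Coinvariants.mk (Representation.restrictUnipotentGL F (lastBlockLabel 3) (Representation.smoothIndRep (standardParabolicGL F (lastBlockLabel 3)) τ))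
      ((Representation.smoothIndRep (standardParabolicGL F (lastBlockLabel 3)) τ) ((r : GL (Fin 3) F))⁻¹ (cellSection τ (monotone_lastBlockLabel 3) hτs K' (isOpen_comap_congruenceGL hγ0)
        (isCompact_comap_congruenceGL _) w))) := fun w => rfl
  show μ (f.toFun (permGL Fin.revPerm * (r : GL (Fin 3) F))) = 0
  -- (i) `μ` kills the Jacquet kernel
  have hμker : ∀ w ∈ Representation.Coinvariants.ker (τ.comp ι), μ w = 0 := by
    intro w hw
    rw [hμ, ← Subgroup.coe_inv,
      mk_translate_cellSection_eq_zero_of_mem_jacquet_ker τ hτs ι hι hγ1 hγ0 (r⁻¹).2 hw, map_zero]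
  -- (ii) `e • μ w = q • μ (τ(d₀ ϖ) w)`
  have hμd : ∀ w : W, e • μ w = (IsNonarchimedeanLocalField.residueFieldCard F : ℂ) •
      μ (τ ⟨diagGL (Fin 3) (Function.update 1 0 (Units.mk0 ϖ hϖ.ne_zero)), diagGL_mem_standardParabolicGL _ _⟩ w) := by
    intro w
    have h1 := hΛ ⟨diagGL (Fin 3) (Function.update 1 (Fin.last 2) (Units.mk0 ϖ hϖ.ne_zero)),
      diagGL_mem_standardParabolicGL _ _⟩
      ((Representation.smoothIndRep (standardParabolicGL F (lastBlockLabel 3)) τ) ((r : GL (Fin 3) F))⁻¹ (cellSection τ (monotone_lastBlockLabel 3) hτs K' (isOpen_comap_congruenceGL hγ0)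
        (isCompact_comap_congruenceGL _) w))
    rw [he] at h1
    rw [hμ, hμ, ← h1, mk_smoothIndRep_diag_translate_cellSection τ hτs hϖ hm1 r w, map_smul]
  -- (iii) regularity
  obtain ⟨w', hw'⟩ := hreg (f.toFun (permGL Fin.revPerm * (r : GL (Fin 3) F)))
  have hsplit : f.toFun (permGL Fin.revPerm * (r : GL (Fin 3) F)) =
      ((IsNonarchimedeanLocalField.residueFieldCard F : ℂ) • τ ⟨diagGL (Fin 3) (Function.update 1 0 (Units.mk0 ϖ hϖ.ne_zero)),
          diagGL_mem_standardParabolicGL _ _⟩ w' - e • w') -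
        ((IsNonarchimedeanLocalField.residueFieldCard F : ℂ) • τ ⟨diagGL (Fin 3) (Function.update 1 0 (Units.mk0 ϖ hϖ.ne_zero)),
          diagGL_mem_standardParabolicGL _ _⟩ w' - e • w' - f.toFun (permGL Fin.revPerm * (r : GL (Fin 3) F))) := by
    abel
  rw [hsplit, map_sub, hμker _ hw', sub_zero, map_sub, map_smul, map_smul, ← hμd w', sub_self]


/-! ## §2 `End_{GL₃}(n-Ind_{P(2,1)}(σ ⊠ χ′)) = ℂ` for REGULAR `u₁₀`-exponent -/

/-- **`End_{GL₃(F)}(n-Ind_{P(2,1)}^{GL₃(F)}(σ ⊠ χ′)) = ℂ` when `σ(diag(ϖ,1)) - √q·χ′(ϖ)` is surjective modulo the `u₁₀`-Jacquet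
kernel** (ROAD β, regular non-supercuspidal branch of S1#7 `SocketSplitInducedIrreducible`: «if `v` splits in `E` … an L-packet
consists of a single irreducible representation» [Rogawski1990, §13.3 p. 201]).  `F` a non-archimedean local field (ANY
characteristic), `σ` an irreducible smooth representation of the `GL₂`-block, `χ′` continuous, `ϖ` a uniformizer.  HYPOTHESIS
`hreg`: for every `w` there is `w'` with `σ(diag(ϖ,1)) w' - √q χ′(ϖ) w' ≡ w` modulo `⟨σ(u₁₀ b) y - y⟩` (`diag(ϖ,1)` = the
`GL₂`-block of `d₀(ϖ) = diag(ϖ,1,1)`; i.e. `√q χ′(ϖ)` is not an eigenvalue of `diag(ϖ,1)` on the finite Jacquet module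
`W_{u₁₀(F)}` — the supercuspidal case `W_{u₁₀(F)} = 0` is ★ `parabolicIndGL_intertwiningMap_eq_smul_of_jacquet_root_trivial`).
CONCLUSION: every intertwining operator of the socket's `parabolicIndGL F (lastBlockLabel 3) (σ ⊠ χ′)` (term VERBATIM) is a scalar.
Proof: ★ `smoothIndRep_intertwiningMap_eq_smul_of_openCell_killed` with the open cell killed by the exponent comparison of §1
(`τ(d(ϖ)) = q χ′(ϖ)` on the closed side against `q · τ(d₀(ϖ)) = √q σ(diag(ϖ,1))` on the open side, ★ `R90S1SplitInducingDatumValues`).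
[cite: BernsteinZelevinskyASENS1977, Thm. 5.2 and §7.1] [cite: Rogawski1990, §13.3 p. 201] [cite: Zelevinsky1980, Thm. 4.2] -/
theorem parabolicIndGL_intertwiningMap_eq_smul_of_regular_exponent
    {F : Type*} [Field F] [ValuativeRel F] [TopologicalSpace F] [IsNonarchimedeanLocalField F]
    [LocallyCompactSpace (standardParabolicGL F (lastBlockLabel 3))]
    {W : Type*} [AddCommGroup W] [Module ℂ W]
    (σ : Representation ℂ (GL {i : Fin 3 // lastBlockLabel 3 i = false} F) W)
    (hσi : σ.IsIrreducible) (hσs : σ.IsSmooth)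
    (χ' : Fˣ →* ℂˣ) (hχ'c : Continuous fun x => ((χ' x : ℂˣ) : ℂ))
    {ϖ : F} (hϖ : IsUniformizingElement ϖ)
    (hreg : ∀ w : W, ∃ w' : W,
      σ (leviProjection F (lastBlockLabel 3)
          ⟨diagGL (Fin 3) (Function.update 1 0 (Units.mk0 ϖ hϖ.ne_zero)), diagGL_mem_standardParabolicGL _ _⟩ false) w' -
        ((Real.sqrt (IsNonarchimedeanLocalField.residueFieldCard F : ℝ) : ℂ) * ((χ' (Units.mk0 ϖ hϖ.ne_zero) : ℂˣ) : ℂ)) • w' -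
          w ∈ Submodule.span ℂ (Set.range fun bw : F × W =>
            σ (transvectionGL (⟨1, by decide⟩ : {i : Fin 3 // lastBlockLabel 3 i = false}) ⟨0, by decide⟩ (by decide) bw.1) bw.2
              - bw.2))
    (T : (Representation.parabolicIndGL F (lastBlockLabel 3)
        (Representation.twist
          (σ.comp (Pi.evalMonoidHom (fun a : Bool => GL {i : Fin 3 // lastBlockLabel 3 i = a} F) false))
          (χ'.comp (Matrix.GeneralLinearGroup.det.comp
            (Pi.evalMonoidHom (fun a : Bool => GL {i : Fin 3 // lastBlockLabel 3 i = a} F) true))))).IntertwiningMap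
      (Representation.parabolicIndGL F (lastBlockLabel 3)
        (Representation.twist
          (σ.comp (Pi.evalMonoidHom (fun a : Bool => GL {i : Fin 3 // lastBlockLabel 3 i = a} F) false))
          (χ'.comp (Matrix.GeneralLinearGroup.det.comp
            (Pi.evalMonoidHom (fun a : Bool => GL {i : Fin 3 // lastBlockLabel 3 i = a} F) true)))))) :
    ∃ c : ℂ, ∀ f, T f = c • f := by
  classical
  haveI := hσi
  let ι : Multiplicative F →* ↥(standardParabolicGL F (lastBlockLabel 3)) :=
    (Matrix.SpecialLinearGroup.toGL.comp (transvectionHom (1 : Fin 3) 0 (by decide))).codRestrict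
      (standardParabolicGL F (lastBlockLabel 3)) (fun x => u10_mem_standardParabolicGL (F := F) x.toAdd)
  have hι : ∀ b : F, ((ι (Multiplicative.ofAdd b) : ↥(standardParabolicGL F (lastBlockLabel 3))) : GL (Fin 3) F) =
      transvectionGL (1 : Fin 3) 0 (by decide) b := fun b => rfl
  haveI := SplitDatum.secondCountableTopology_glBlock (F := F)
  refine smoothIndRep_intertwiningMap_eq_smul_of_openCell_killed _ (SplitDatum.twistDatum_unipotent σ χ') ?_ σ
    (fun L hL => Representation.IsIrreducible.exists_eq_smul_id_of_rank_le_aleph0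
      (rank_le_aleph0_of_isSmooth_of_isIrreducible σ hσs) L hL)
    (fun A => leviEmbeddingP F (lastBlockLabel 3) (Pi.mulSingle false A))
    (fun A => ((rootDeltaChar (standardParabolicGL F (lastBlockLabel 3))
      (leviEmbeddingP F (lastBlockLabel 3) (Pi.mulSingle false A)) : ℂˣ) : ℂ))
    (fun A => Units.ne_zero _) (SplitDatum.twistDatum_leviEmbedding σ χ') T
  intro Λ hΛ f hf
  refine openCell_killed_of_regular _
    (Representation.IsSmooth.twist_comp_leviProjection F (lastBlockLabel 3) (SplitDatum.isSmooth_leviDatum σ χ' hσs hχ'c))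
    ι hι hϖ _ (SplitDatum.twistDatum_diag_last σ χ' hϖ) ?_ Λ hΛ f hf
  -- the regular-exponent hypothesis for `τ`: `q τ(d₀ ϖ) w' - q χ′(ϖ) w' = σ(diag(ϖ,1)) w'' - √q χ′(ϖ) w''`, `w' = (√q)⁻¹ w''`
  intro w
  obtain ⟨w'', hw''⟩ := hreg w
  have hr0 : (Real.sqrt (IsNonarchimedeanLocalField.residueFieldCard F : ℝ) : ℂ) ≠ 0 := sqrt_residueFieldCard_ne_zero (F := F)
  have hr2 : (Real.sqrt (IsNonarchimedeanLocalField.residueFieldCard F : ℝ) : ℂ) *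
      (Real.sqrt (IsNonarchimedeanLocalField.residueFieldCard F : ℝ) : ℂ) = (IsNonarchimedeanLocalField.residueFieldCard F : ℂ) := by
    rw [← Complex.ofReal_mul, Real.mul_self_sqrt (Nat.cast_nonneg _), Complex.ofReal_natCast]
  refine ⟨(Real.sqrt (IsNonarchimedeanLocalField.residueFieldCard F : ℝ) : ℂ)⁻¹ • w'', ?_⟩
  rw [SplitDatum.twistDatum_diag_zero σ χ' hϖ, map_smul, smul_smul, smul_smul, smul_smul, ← hr2,
    show (Real.sqrt (IsNonarchimedeanLocalField.residueFieldCard F : ℝ) : ℂ) *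
        (Real.sqrt (IsNonarchimedeanLocalField.residueFieldCard F : ℝ) : ℂ) *
        ((Real.sqrt (IsNonarchimedeanLocalField.residueFieldCard F : ℝ) : ℂ))⁻¹ *
        ((Real.sqrt (IsNonarchimedeanLocalField.residueFieldCard F : ℝ) : ℂ))⁻¹ = 1 by field_simp, one_smul,
    show (Real.sqrt (IsNonarchimedeanLocalField.residueFieldCard F : ℝ) : ℂ) *
        (Real.sqrt (IsNonarchimedeanLocalField.residueFieldCard F : ℝ) : ℂ) * ((χ' (Units.mk0 ϖ hϖ.ne_zero) : ℂˣ) : ℂ) *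
        ((Real.sqrt (IsNonarchimedeanLocalField.residueFieldCard F : ℝ) : ℂ))⁻¹ =
      (Real.sqrt (IsNonarchimedeanLocalField.residueFieldCard F : ℝ) : ℂ) * ((χ' (Units.mk0 ϖ hϖ.ne_zero) : ℂˣ) : ℂ) by
        field_simp]
  exact SplitDatum.span_jacquet_le_ker σ χ' ι hι hw''

end Summit.HodgeConjecture.HodgeConjecture.R90.S1

end
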